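import Literature.NumberTheory.GaloisCohomology.Howard2004.IsotropyDescentProofs
import Literature.NumberTheory.GaloisCohomology.Howard2004.TransportConnectingKernelProofs
import HarnessLib

/-!
# Howard 2004, Remark 1.3.1: H.4 — the EXACT self-orthogonality of the local conditions — descends
# along a quotient `T ↠ T/IT` with change of coefficient ring (theorems only)

Topic `NumberTheory/GaloisCohomology/Howard2004`. THEOREMS ONLY: no definition, no named fact, no instance, no
notation, no `sorry`. Cell `pub/bsd-print-x9`, print leaf G87
`Literature.NumberTheory.GaloisCohomology.Howard2004.thm161_dvrKolyvaginBound` (Howard Thm. 1.6.1); seat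
`bsd-line-x10b-p1` LEAD g12 — brick «R4-CORE / H.4♯» of the π-adic REFINEMENT of a `DVRSetting` (the refined
setting must satisfy `SatisfiesH.h4` at EVERY exponent; `IsotropyDescentProofs` gave the isotropy half only,
«NOT HERE: the opposite inclusion»). Generic over a presentation and two duality data; the refinement lineage
instantiates (`T = T^{(k)}` free over `R_k = R/π^{e_k}`, `T/IT = T^{(k)}/π^j`, `Ā = R/π^j`, `f = ×π^{e_k-j}`).

SOURCE. B. Howard, *The Heegner point Kolyvagin system*, Compositio Math. **140** (2004) = arXiv:1202.6340, §1.3: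
H.4 «We assume that the local condition `𝓕` is its own exact orthogonal complement under the induced local pairing
`⟨ , ⟩_v : H¹(K_v,T) × H¹(K_v̄,T) → R` for every place `v` of `K`» (p. 7 L78–82); Remark 1.3.1 «It is easily seen
that hypotheses H.0–H.5 are stable under base change in the obvious sense» (p. 7 L125–127); Def. 1.1.2–1.1.3
(cartesian local conditions on `Quot(T)`, p. 5 L88–99) and Remark 1.1.4 (`T/𝔪^iT →(π^{k-i}) T[𝔪^i]`, p. 5 L100–105).

THE ARGUMENT (the «obvious sense» made explicit; no counting, no local Tate duality). Data: `π̄ : T ↠ T/IT`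
(`IsQuotientBy`, over the base ring `R`), H.4 data `D` on `T` (coefficients `A`) and `D̄` on `T/IT` (coefficients
`Ā`), compatible FORWARD through an additive `ℤ_p`-linear `ψ : A → Ā`, `ē(π̄ s, π̄ t) = ψ(e(s,t))`, and BACKWARD
along an additive `Γ_K`-equivariant `f : T/IT → T` through an additive `ℤ_p`-linear `μ : Ā → A`,
`e(s, f t̄) = μ(ē(π̄ s, t̄))`; the condition `𝓕` is `f`-cartesian at `v` and `σ v` (`𝓕̄_w := π̄_* 𝓕_w = f_*⁻¹ 𝓕_w`,
which is H.3 for the injective `Quot(T)`-morphism `f`, §4).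
* isotropy (`𝓕̄_v ⊥ transport 𝓕̄_{σv}`): cup-product functoriality for the triple `(π̄, π̄, ψ)` (§2,
  `localCup_localCohomologyMap_eq_zero_of_ringChange`, = w5 g7's lemma with `c·` replaced by `ψ`);
* exactness, first clause: if `x̄ ⊥ transport 𝓕̄_{σv}` then `f_* x̄ ⊥ transport 𝓕_{σv}` — because
  `f_* x̄ ∪_e y = μ_*(x̄ ∪_ē (Tw π̄)_* y)` (§2, mixed pairing `Q'(s̄,t) = ē(s̄, π̄ t)`, triples `(id, π̄, id)` and
  `(f, id, μ)`) and `(Tw π̄)_* transport = transport π̄_*` — so `f_* x̄ ∈ 𝓕_v` by H.4 for `T`, i.e. `x̄ ∈ 𝓕̄_v`;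
* exactness, second clause: write `ȳ = transport w̄` (transport is onto, `TransportConnectingKernelProofs`); if
  `𝓕̄_v ⊥ ȳ` then `𝓕_v ⊥ (Tw f)_* ȳ = transport (f_* w̄)` — because `x ∪_e (Tw f)_* ȳ = μ_*(π̄_* x ∪_ē ȳ)` (§2,
  mixed pairing `Q(s,t̄) = ē(π̄ s, t̄)`, triples `(π̄, id, id)` and `(id, f, μ)`) — so `transport (f_* w̄) ∈
  transport 𝓕_{σv}` by H.4 for `T`, `f_* w̄ ∈ 𝓕_{σv}` (transport injective), `w̄ ∈ 𝓕̄_{σv}`, `ȳ ∈ transport 𝓕̄_{σv}`.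

WHAT IS PROVED.
* §1 `ConjugationDatum.transportH1_cohomologyMap_of_equivariant` — transport commutes with `H¹` of any
  equivariant additive map (for `π̄` this is `IsQuotientBy.transportH1_localCohomologyMap`).
* §2 `DualityDatum.localCup_cohomologyMap_twist_eq_zero`, `DualityDatum.localCup_cohomologyMap_eq_zero` (the two
  backward functorialities, vanishing form), `DualityDatum.localCup_localCohomologyMap_eq_zero_of_ringChange`.
* §3 **`DualityDatum.isSelfOrthogonalAt_propagateStructure`**:
  `D.IsSelfOrthogonalAt 𝓕 v → D̄.IsSelfOrthogonalAt (hq.propagateStructure 𝓕) v` under the data above.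
* §4 `IsQuotientBy.propagate_of_id`, **`DualityDatum.isSelfOrthogonalAt_propagateStructure_of_isCartesianOnQuotAt`**
  — the same with the `f`-cartesian identities derived from `IsCartesianOnQuotAt ρ R w (𝓕 w)` (H.3) at `w = v, σ v`
  for `f` an injective `IsQuotMorphism ρ I J ρ̄ π̄ ρ id r f` (`J·T = 0`).

HONEST FRAMING. Pure Galois-cohomology plumbing (functoriality of cup products and of Howard's transport) on top of
Howard's Def. 1.1.2–1.1.3 / H.3 / H.4; the EXISTENCE of the reduced datum `D̄` (perfectness over `Ā`) and the
discharge of the two compatibilities and of cartesianity outside `Σ(𝓕)` (Lemma 1.1.5) are the consumer's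
(REFINE R4a/R3). `thm161_dvrKolyvaginBound` is NOT proved; no summit statement is proved; the
Birch–Swinnerton-Dyer conjecture is not proved by any of this.
References: [Howard2004HeegnerKolyvagin] §1.3 H.3–H.4, Remark 1.3.1, Def. 1.1.2–1.1.3, Remark 1.1.4;
[NeukirchSchmidtWingberg2008] I §4 (1.4.2) (functoriality of cup products); [SerreGaloisCohomology1997] I §2.2, §2.4.
-/

set_option autoImplicit false

noncomputable section

open Function NumberField IsDedekindDomain Field CategoryTheory
open scoped NumberField

namespace Literature.NumberTheory.GaloisCohomology.Howard2004

open Literature.NumberTheory.GaloisRepresentations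
open Literature.NumberTheory.GaloisRepresentations.DiscreteGaloisModule

/-! ## §0 `Hⁿ(𝟙) = id` (Mathlib `ContinuousCohomology.map_id`, in the tree's `cohomologyMap` spelling) -/

section IdHelper

universe w

variable {k : Type*} [Ring k] [TopologicalSpace k] {G : Type w} [Group G] [TopologicalSpace G]
  [IsTopologicalGroup G] {X : TopRep.{w} k G}

/-- `Hⁿ(𝟙) x = x`. [cite: SerreGaloisCohomology1997, I §2.2] -/
private theorem cohomologyMap_id_apply₀ (n : ℕ) (x : continuousCohomology n X) :
    cohomologyMap (𝟙 X) n x = x := by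
  rw [show cohomologyMap (𝟙 X) n = 𝟙 _ from
    continuousCohomology_map_eq_id (ContinuousMonoidHom.id G) (resIdHom (𝟙 X)) rfl (fun _ => rfl) n]
  rfl

end IdHelper

variable {K : Type} [Field K] [NumberField K]
  {R : Type} [CommRing R]
  {M : Type} [AddCommGroup M] [TopologicalSpace M] [DiscreteTopology M] [Module R M]
  {Nbar : Type} [AddCommGroup Nbar] [TopologicalSpace Nbar] [DiscreteTopology Nbar] [Module R Nbar]
  {cd : ConjugationDatum K} {ρ : DiscreteGaloisModule K M} {ρbar : DiscreteGaloisModule K Nbar}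

/-! ## §1 Transport commutes with `H¹` of any equivariant map -/

namespace ConjugationDatum

/-- **`transport_v ∘ H¹(K_{σ v}, f) = H¹(K_v, Tw f) ∘ transport_v`** for an additive `Γ_K`-equivariant
`f : N → M` of discrete modules: both send `[y]` to `[g ↦ δ_v · f (y (φ_v g))]`.
[cite: Howard2004HeegnerKolyvagin, §1.3 (arXiv p. 7 L44–48) and Def. 1.1.3 (p. 5 L93–99)] -/
theorem transportH1_cohomologyMap_of_equivariant (cd : ConjugationDatum K)
    (ρbar : DiscreteGaloisModule K Nbar) (ρ : DiscreteGaloisModule K M) (f : Nbar →+ M)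
    (hf : ∀ (g : absoluteGaloisGroup K) (x : Nbar), f (ρbar g x) = ρ g (f x))
    (v : HeightOneSpectrum (𝓞 K)) (y : galoisCohomology (ρbar.toLocal (Sum.inr (cd.σ • v))) 1) :
    cd.transportH1 ρ v
        (ContinuousRep.cohomologyMap (ρbar.toLocal (Sum.inr (cd.σ • v))) (ρ.toLocal (Sum.inr (cd.σ • v)))
          f continuous_of_discreteTopology (fun _ x => hf _ x) 1 y) =
      ContinuousRep.cohomologyMap ((cd.twist ρbar).toLocal (Sum.inr v)) ((cd.twist ρ).toLocal (Sum.inr v))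
        f continuous_of_discreteTopology (fun g x => hf (cd.conj (absGaloisRestrict K _ g)) x) 1
        (cd.transportH1 ρbar v y) := by
  obtain ⟨c, rfl⟩ := oneCocycleClass_surjective _ y
  have h1 : ContinuousRep.cohomologyMap (ρbar.toLocal (Sum.inr (cd.σ • v))) (ρ.toLocal (Sum.inr (cd.σ • v)))
      f continuous_of_discreteTopology (fun _ x => hf _ x) 1 (oneCocycleClass _ c) = oneCocycleClass _
      (contOneCocycles.pullback (ContinuousMonoidHom.id _)
        (X := (ρbar.toLocal (Sum.inr (cd.σ • v))).toTopRep) (Y := (ρ.toLocal (Sum.inr (cd.σ • v))).toTopRep)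
        (TopRep.ofHom ⟨⟨f.toIntLinearMap, continuous_of_discreteTopology⟩,
          fun g => ContinuousLinearMap.ext fun m => hf _ m⟩) c) :=
    map_oneCocycleClass _ _ _ c
  rw [h1, ConjugationDatum.transportH1_oneCocycleClass, ConjugationDatum.transportH1_oneCocycleClass]
  refine Eq.trans ?_ (map_oneCocycleClass _ _ _ _).symm
  congr 1
  refine Subtype.ext (ContinuousMap.ext fun g => ?_)
  change ρ (cd.δ v) (f (c.1 (cd.φ v g))) = f (ρbar (cd.δ v) (c.1 (cd.φ v g)))
  rw [hf]

end ConjugationDatum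

/-! ## §2 The mixed pairing `Q(s, t̄) = ē(π̄ s, t̄)` and the two cup-product functorialities -/

namespace DualityDatum

variable {A : Type} [CommRing A] [TopologicalSpace A] [DiscreteTopology A] [Module A M]
  {Abar : Type} [CommRing Abar] [TopologicalSpace Abar] [DiscreteTopology Abar] [Module Abar Nbar]
  {p : ℕ} [Fact p.Prime] [Algebra ℤ_[p] A] [Algebra ℤ_[p] Abar]
  {I : Ideal R} {πbar : M →ₗ[R] Nbar}

/-- **Backward cup functoriality along an injective `Quot`-morphism, vanishing form.** Let
`π̄ : T ↠ T/IT` present the quotient, `D` be H.4 data on `T` (coefficients `A`), `D̄` H.4 data on `T/IT`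
(coefficients `Ā`), `f : T/IT → T` an additive `Γ_K`-equivariant map and `μ : Ā → A` additive and
`ℤ_p`-linear with `e(s, f t̄) = μ(ē(π̄ s, t̄))` (for the refinement: `f = ×π^{e-i}`, `μ(ā) = π^{e-i} a`). Then for
`x ∈ H¹(K_v, T)` and `ȳ ∈ H¹(K_v, Tw(T/IT))`: `π̄_* x ∪_ē ȳ = 0 ⟹ x ∪_e (Tw f)_* ȳ = 0` — both cup products are images
of `x ∪_Q ȳ` for the mixed pairing `Q(s, t̄) = ē(π̄ s, t̄) : T × Tw(T/IT) → Ā(1)` (functoriality for the triples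
`(π̄, id, id)` and `(id, f, μ)`).
[cite: Howard2004HeegnerKolyvagin, §1.3 H.4 and Remark 1.3.1 (arXiv p. 7 L69–82, L125–127)] [cite: NeukirchSchmidtWingberg2008, I §4 (1.4.2)] -/
theorem localCup_cohomologyMap_twist_eq_zero (hq : IsQuotientBy ρ I ρbar πbar)
    (D : DualityDatum p cd ρ A) (Dbar : DualityDatum p cd ρbar Abar)
    (f : Nbar →+ M) (hf : ∀ (g : absoluteGaloisGroup K) (x : Nbar), f (ρbar g x) = ρ g (f x))
    (μ : Abar →+ A) (hμ : ∀ (c : ℤ_[p]) (b : Abar), μ (algebraMap ℤ_[p] Abar c * b) = algebraMap ℤ_[p] A c * μ b)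
    (hμe : ∀ (s : M) (t : Nbar), D.e s (f t) = μ (Dbar.e (πbar s) t))
    (v : HeightOneSpectrum (𝓞 K)) (x : galoisCohomology (ρ.toLocal (Sum.inr v)) 1)
    (y : galoisCohomology ((cd.twist ρbar).toLocal (Sum.inr v)) 1)
    (h : Dbar.localCup (Sum.inr v) (hq.localCohomologyMap (Sum.inr v) 1 x) y = 0) :
    D.localCup (Sum.inr v) x
      (ContinuousRep.cohomologyMap ((cd.twist ρbar).toLocal (Sum.inr v)) ((cd.twist ρ).toLocal (Sum.inr v))
        f continuous_of_discreteTopology (fun g t => hf (cd.conj (absGaloisRestrict K _ g)) t) 1 y) = 0 := by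
  haveI : CompactSpace (absoluteGaloisGroup (Place.Completion (Sum.inr v : Place K))) :=
    absoluteGaloisGroup_compactSpace _
  -- the mixed pairing `Q(s, t̄) = ē(π̄ s, t̄)` on `T × Tw(T/IT) → Ā(1)`
  let Q : ContPairing (ρ.toLocal (Sum.inr v)).toTopRep ((cd.twist ρbar).toLocal (Sum.inr v)).toTopRep
      (Dbar.twistOne.toLocal (Sum.inr v)).toTopRep :=
    DiscreteGaloisModule.pairing (ρ.toLocal (Sum.inr v)) ((cd.twist ρbar).toLocal (Sum.inr v))
      (Dbar.twistOne.toLocal (Sum.inr v)) (Dbar.eHom.comp πbar.toAddMonoidHom) fun g s t => by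
        change Dbar.eHom (πbar (ρ (absGaloisRestrict K _ g) s)) (cd.twist ρbar (absGaloisRestrict K _ g) t) =
          Dbar.twistOne (absGaloisRestrict K _ g) (Dbar.eHom (πbar s) t)
        rw [hq.equivariant, Dbar.eHom_equivariant]
  -- the morphisms
  let α : (ρ.toLocal (Sum.inr v)).toTopRep ⟶ (ρbar.toLocal (Sum.inr v)).toTopRep :=
    TopRep.ofHom ⟨⟨πbar.toAddMonoidHom.toIntLinearMap, continuous_of_discreteTopology⟩,
      fun g => ContinuousLinearMap.ext fun m => hq.equivariant _ m⟩
  let β : ((cd.twist ρbar).toLocal (Sum.inr v)).toTopRep ⟶ ((cd.twist ρ).toLocal (Sum.inr v)).toTopRep :=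
    TopRep.ofHom ⟨⟨f.toIntLinearMap, continuous_of_discreteTopology⟩,
      fun g => ContinuousLinearMap.ext fun t => hf (cd.conj (absGaloisRestrict K _ g)) t⟩
  let γ : (Dbar.twistOne.toLocal (Sum.inr v)).toTopRep ⟶ (D.twistOne.toLocal (Sum.inr v)).toTopRep :=
    TopRep.ofHom ⟨⟨μ.toIntLinearMap, continuous_of_discreteTopology⟩,
      fun g => ContinuousLinearMap.ext fun b => by
        change μ (Dbar.twistOne (absGaloisRestrict K _ g) b) = D.twistOne (absGaloisRestrict K _ g) (μ b)
        rw [D.twistOne_apply, Dbar.twistOne_apply, hμ]⟩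
  -- `H¹(π̄)` is `cohomologyMap α`, `H¹(Tw f)` is `cohomologyMap β`
  have hα : hq.localCohomologyMap (Sum.inr v) 1 x = cohomologyMap α 1 x := by
    obtain ⟨χ, rfl⟩ := oneCocycleClass_surjective _ x
    exact (map_oneCocycleClass _ _ _ χ).trans (cohomologyMap_oneCocycleClass α χ).symm
  have hβ : ContinuousRep.cohomologyMap ((cd.twist ρbar).toLocal (Sum.inr v)) ((cd.twist ρ).toLocal (Sum.inr v))
      f continuous_of_discreteTopology (fun g t => hf (cd.conj (absGaloisRestrict K _ g)) t) 1 y =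
      cohomologyMap β 1 y := by
    obtain ⟨χ, rfl⟩ := oneCocycleClass_surjective _ y
    exact (map_oneCocycleClass _ _ _ χ).trans (cohomologyMap_oneCocycleClass β χ).symm
  -- functoriality for `(π̄, id, id)`: `x ∪_Q ȳ = π̄_* x ∪_ē ȳ`
  have h1 := ContPairing.cupProduct_map Q (Dbar.ePairingLocal (Sum.inr v)) α (𝟙 _) (𝟙 _)
    (fun s t => rfl) x y
  rw [cohomologyMap_id_apply₀, cohomologyMap_id_apply₀] at h1
  -- functoriality for `(id, f, μ)`: `μ_* (x ∪_Q ȳ) = x ∪_e (Tw f)_* ȳ`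
  have h2 := ContPairing.cupProduct_map Q (D.ePairingLocal (Sum.inr v)) (𝟙 _) β γ
    (fun s t => (hμe s t).symm) x y
  rw [cohomologyMap_id_apply₀] at h2
  rw [hβ]
  change (D.ePairingLocal (Sum.inr v)).cupProduct x (cohomologyMap β 1 y) = 0
  rw [← h2, h1]
  change cohomologyMap γ 2 (Dbar.localCup (Sum.inr v) (cohomologyMap α 1 x) y) = 0
  rw [← hα, h]
  exact map_zero _

/-- **The flipped backward functoriality, vanishing form**: with the same data, for `x̄ ∈ H¹(K_v, T/IT)` and
`y ∈ H¹(K_v, Tw T)`: `x̄ ∪_ē (Tw π̄)_* y = 0 ⟹ f_* x̄ ∪_e y = 0` (mixed pairing `Q'(s̄, t) = ē(s̄, π̄ t)`, triples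
`(id, π̄, id)` and `(f, id, μ)`; the compatibility `e(f s̄, t) = μ(ē(s̄, π̄ t))` follows from the given one by the
symmetry of both pairings).
[cite: Howard2004HeegnerKolyvagin, §1.3 H.4 and Remark 1.3.1 (arXiv p. 7 L69–82, L125–127)] [cite: NeukirchSchmidtWingberg2008, I §4 (1.4.2)] -/
theorem localCup_cohomologyMap_eq_zero (hq : IsQuotientBy ρ I ρbar πbar)
    (D : DualityDatum p cd ρ A) (Dbar : DualityDatum p cd ρbar Abar)
    (f : Nbar →+ M) (hf : ∀ (g : absoluteGaloisGroup K) (x : Nbar), f (ρbar g x) = ρ g (f x))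
    (μ : Abar →+ A) (hμ : ∀ (c : ℤ_[p]) (b : Abar), μ (algebraMap ℤ_[p] Abar c * b) = algebraMap ℤ_[p] A c * μ b)
    (hμe : ∀ (s : M) (t : Nbar), D.e s (f t) = μ (Dbar.e (πbar s) t))
    (v : HeightOneSpectrum (𝓞 K)) (x : galoisCohomology (ρbar.toLocal (Sum.inr v)) 1)
    (y : galoisCohomology ((cd.twist ρ).toLocal (Sum.inr v)) 1)
    (h : Dbar.localCup (Sum.inr v) x
      (ContinuousRep.cohomologyMap ((cd.twist ρ).toLocal (Sum.inr v)) ((cd.twist ρbar).toLocal (Sum.inr v))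
        πbar.toAddMonoidHom continuous_of_discreteTopology
        (fun g m => hq.equivariant (cd.conj (absGaloisRestrict K _ g)) m) 1 y) = 0) :
    D.localCup (Sum.inr v)
      (ContinuousRep.cohomologyMap (ρbar.toLocal (Sum.inr v)) (ρ.toLocal (Sum.inr v)) f
        continuous_of_discreteTopology (fun _ t => hf _ t) 1 x) y = 0 := by
  haveI : CompactSpace (absoluteGaloisGroup (Place.Completion (Sum.inr v : Place K))) :=
    absoluteGaloisGroup_compactSpace _
  have hμe' : ∀ (s : Nbar) (t : M), D.e (f s) t = μ (Dbar.e s (πbar t)) := fun s t => by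
    rw [D.symm, hμe, Dbar.symm]
  -- the mixed pairing `Q'(s̄, t) = ē(s̄, π̄ t)` on `T/IT × Tw(T) → Ā(1)`
  let Q : ContPairing (ρbar.toLocal (Sum.inr v)).toTopRep ((cd.twist ρ).toLocal (Sum.inr v)).toTopRep
      (Dbar.twistOne.toLocal (Sum.inr v)).toTopRep :=
    DiscreteGaloisModule.pairing (ρbar.toLocal (Sum.inr v)) ((cd.twist ρ).toLocal (Sum.inr v))
      (Dbar.twistOne.toLocal (Sum.inr v)) (Dbar.eHom.flip.comp πbar.toAddMonoidHom).flip fun g s t => by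
        change Dbar.eHom (ρbar (absGaloisRestrict K _ g) s) (πbar (cd.twist ρ (absGaloisRestrict K _ g) t)) =
          Dbar.twistOne (absGaloisRestrict K _ g) (Dbar.eHom s (πbar t))
        rw [ConjugationDatum.twist_apply, hq.equivariant, ← ConjugationDatum.twist_apply cd ρbar,
          Dbar.eHom_equivariant]
  let α : (ρbar.toLocal (Sum.inr v)).toTopRep ⟶ (ρ.toLocal (Sum.inr v)).toTopRep :=
    TopRep.ofHom ⟨⟨f.toIntLinearMap, continuous_of_discreteTopology⟩,
      fun g => ContinuousLinearMap.ext fun t => hf _ t⟩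
  let β : ((cd.twist ρ).toLocal (Sum.inr v)).toTopRep ⟶ ((cd.twist ρbar).toLocal (Sum.inr v)).toTopRep :=
    TopRep.ofHom ⟨⟨πbar.toAddMonoidHom.toIntLinearMap, continuous_of_discreteTopology⟩,
      fun g => ContinuousLinearMap.ext fun m => hq.equivariant (cd.conj (absGaloisRestrict K _ g)) m⟩
  let γ : (Dbar.twistOne.toLocal (Sum.inr v)).toTopRep ⟶ (D.twistOne.toLocal (Sum.inr v)).toTopRep :=
    TopRep.ofHom ⟨⟨μ.toIntLinearMap, continuous_of_discreteTopology⟩,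
      fun g => ContinuousLinearMap.ext fun b => by
        change μ (Dbar.twistOne (absGaloisRestrict K _ g) b) = D.twistOne (absGaloisRestrict K _ g) (μ b)
        rw [D.twistOne_apply, Dbar.twistOne_apply, hμ]⟩
  have hα : ContinuousRep.cohomologyMap (ρbar.toLocal (Sum.inr v)) (ρ.toLocal (Sum.inr v)) f
      continuous_of_discreteTopology (fun _ t => hf _ t) 1 x = cohomologyMap α 1 x := by
    obtain ⟨χ, rfl⟩ := oneCocycleClass_surjective _ x
    exact (map_oneCocycleClass _ _ _ χ).trans (cohomologyMap_oneCocycleClass α χ).symm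
  have hβ : ContinuousRep.cohomologyMap ((cd.twist ρ).toLocal (Sum.inr v)) ((cd.twist ρbar).toLocal (Sum.inr v))
      πbar.toAddMonoidHom continuous_of_discreteTopology
      (fun g m => hq.equivariant (cd.conj (absGaloisRestrict K _ g)) m) 1 y = cohomologyMap β 1 y := by
    obtain ⟨χ, rfl⟩ := oneCocycleClass_surjective _ y
    exact (map_oneCocycleClass _ _ _ χ).trans (cohomologyMap_oneCocycleClass β χ).symm
  -- `(id, π̄, id)`: `x̄ ∪_{Q'} y = x̄ ∪_ē (Tw π̄)_* y`
  have h1 := ContPairing.cupProduct_map Q (Dbar.ePairingLocal (Sum.inr v)) (𝟙 _) β (𝟙 _)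
    (fun s t => rfl) x y
  rw [cohomologyMap_id_apply₀, cohomologyMap_id_apply₀] at h1
  -- `(f, id, μ)`: `μ_* (x̄ ∪_{Q'} y) = f_* x̄ ∪_e y`
  have h2 := ContPairing.cupProduct_map Q (D.ePairingLocal (Sum.inr v)) α (𝟙 _) γ
    (fun s t => (hμe' s t).symm) x y
  rw [cohomologyMap_id_apply₀] at h2
  rw [hα]
  change (D.ePairingLocal (Sum.inr v)).cupProduct (cohomologyMap α 1 x) y = 0
  rw [← h2, h1]
  change cohomologyMap γ 2 (Dbar.localCup (Sum.inr v) x (cohomologyMap β 1 y)) = 0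
  rw [← hβ, h]
  exact map_zero _

/-- **Isotropy descends along `π̄` with a change of coefficient ring** (w5 g7's
`localCup_localCohomologyMap_eq_zero` with the scalar `c·` replaced by an additive `ℤ_p`-linear
`ψ : A → Ā`): if `ē(π̄ s, π̄ t) = ψ(e(s, t))` then `x ∪_e transport_v y = 0 ⟹ π̄_* x ∪_ē transport_v (π̄_* y) = 0`.
[cite: Howard2004HeegnerKolyvagin, §1.3 H.4 and Remark 1.3.1 (arXiv p. 7 L69–82, L125–127)] [cite: NeukirchSchmidtWingberg2008, I §4 (1.4.2)] -/
theorem localCup_localCohomologyMap_eq_zero_of_ringChange (hq : IsQuotientBy ρ I ρbar πbar)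
    (D : DualityDatum p cd ρ A) (Dbar : DualityDatum p cd ρbar Abar)
    (ψ : A →+ Abar) (hψ : ∀ (c : ℤ_[p]) (a : A), ψ (algebraMap ℤ_[p] A c * a) = algebraMap ℤ_[p] Abar c * ψ a)
    (hψe : ∀ s t : M, Dbar.e (πbar s) (πbar t) = ψ (D.e s t)) (v : HeightOneSpectrum (𝓞 K))
    {x : galoisCohomology (ρ.toLocal (Sum.inr v)) 1}
    {y : galoisCohomology (ρ.toLocal (Sum.inr (cd.σ • v))) 1}
    (h : D.localCup (Sum.inr v) x (cd.transportH1 ρ v y) = 0) :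
    Dbar.localCup (Sum.inr v) (hq.localCohomologyMap (Sum.inr v) 1 x)
      (cd.transportH1 ρbar v (hq.localCohomologyMap (Sum.inr (cd.σ • v)) 1 y)) = 0 := by
  haveI : CompactSpace (absoluteGaloisGroup (Place.Completion (Sum.inr v : Place K))) :=
    absoluteGaloisGroup_compactSpace _
  let α : (ρ.toLocal (Sum.inr v)).toTopRep ⟶ (ρbar.toLocal (Sum.inr v)).toTopRep :=
    TopRep.ofHom ⟨⟨πbar.toAddMonoidHom.toIntLinearMap, continuous_of_discreteTopology⟩,
      fun g => ContinuousLinearMap.ext fun m => hq.equivariant _ m⟩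
  let β : ((cd.twist ρ).toLocal (Sum.inr v)).toTopRep ⟶ ((cd.twist ρbar).toLocal (Sum.inr v)).toTopRep :=
    TopRep.ofHom ⟨⟨πbar.toAddMonoidHom.toIntLinearMap, continuous_of_discreteTopology⟩,
      fun g => ContinuousLinearMap.ext fun m => hq.equivariant _ m⟩
  let γ : (D.twistOne.toLocal (Sum.inr v)).toTopRep ⟶ (Dbar.twistOne.toLocal (Sum.inr v)).toTopRep :=
    TopRep.ofHom ⟨⟨ψ.toIntLinearMap, continuous_of_discreteTopology⟩,
      fun g => ContinuousLinearMap.ext fun r => by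
        change ψ (D.twistOne (absGaloisRestrict K _ g) r) = Dbar.twistOne (absGaloisRestrict K _ g) (ψ r)
        rw [D.twistOne_apply, Dbar.twistOne_apply, hψ]⟩
  have hα : ∀ z, hq.localCohomologyMap (Sum.inr v) 1 z = cohomologyMap α 1 z := by
    intro z
    obtain ⟨χ, rfl⟩ := oneCocycleClass_surjective _ z
    exact (map_oneCocycleClass _ _ _ χ).trans (cohomologyMap_oneCocycleClass α χ).symm
  have hβ : cd.transportH1 ρbar v (hq.localCohomologyMap (Sum.inr (cd.σ • v)) 1 y) =
      cohomologyMap β 1 (cd.transportH1 ρ v y) := by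
    refine (hq.transportH1_localCohomologyMap v y).trans ?_
    obtain ⟨χ, hχ⟩ := oneCocycleClass_surjective _ (cd.transportH1 ρ v y)
    rw [← hχ]
    exact (map_oneCocycleClass _ _ _ χ).trans (cohomologyMap_oneCocycleClass β χ).symm
  have hcup := ContPairing.cupProduct_map (D.ePairingLocal (Sum.inr v)) (Dbar.ePairingLocal (Sum.inr v))
    α β γ (fun s t => (hψe s t).symm) x (cd.transportH1 ρ v y)
  rw [hα, hβ]
  change (Dbar.ePairingLocal (Sum.inr v)).cupProduct (cohomologyMap α 1 x)
    (cohomologyMap β 1 (cd.transportH1 ρ v y)) = 0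
  rw [← hcup]
  change cohomologyMap γ 2 (D.localCup (Sum.inr v) x (cd.transportH1 ρ v y)) = 0
  rw [h]
  exact map_zero _

/-! ## §3 H.4 descends: exact self-orthogonality of the propagated conditions -/

/-- **H.4 base change (Howard, Remark 1.3.1 «hypotheses H.0–H.5 are stable under base change»), the
self-duality clause.** Let `π̄ : T ↠ T/IT` present a quotient (over the base ring `R`), `D` be H.4 data for
`T` over the level ring `A`, `D̄` H.4 data for `T/IT` over `Ā`, compatible FORWARD through an additive
`ℤ_p`-linear `ψ : A → Ā` (`ē(π̄ s, π̄ t) = ψ(e(s,t))`) and BACKWARD along an additive `Γ_K`-equivariant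
`f : T/IT → T` through an additive `ℤ_p`-linear `μ : Ā → A` (`e(s, f t̄) = μ(ē(π̄ s, t̄))`; for a free `T` over
`R/π^e` and `I = (π^i)`: `f = ×π^{e-i}`, the injective `Quot(T)`-morphism `T/π^iT ↪ T`, and `μ(ā) = π^{e-i}a`),
and let the local condition `𝓕` be `f`-CARTESIAN at `v` and at `σ v` (the condition propagated to `T/IT` is the
`f_*`-preimage of `𝓕`; = H.3 read through `IsCartesianOnQuotAt` for the pair `(T/IT ↪ T)`, cf.
`isSelfOrthogonalAt_propagateStructure_of_isCartesianOnQuotAt`). If `𝓕_v` and the transport of `𝓕_{σ v}` are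
exact annihilators of each other under `⟨ , ⟩_v` (H.4 for `T` at `v`), then so are the PROPAGATED conditions
under the pairing of `D̄`: the isotropy halves by cup-product functoriality for `(π̄, π̄, ψ)`, the exactness halves
by functoriality for `(id, f, μ)` / `(f, id, μ)`, H.4 for `T`, the bijectivity of Howard's transport
`H¹(K_{σ v}, ·) ≅ H¹(K_v, Tw ·)` and the cartesian identities. No counting and no local duality is used.
[cite: Howard2004HeegnerKolyvagin, §1.3 H.4 and Remark 1.3.1 (arXiv p. 7 L69–82, L125–127), Def. 1.1.2–1.1.3 (p. 5 L88–99)] -/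
theorem isSelfOrthogonalAt_propagateStructure (hq : IsQuotientBy ρ I ρbar πbar)
    (D : DualityDatum p cd ρ A) (Dbar : DualityDatum p cd ρbar Abar)
    (ψ : A →+ Abar) (hψ : ∀ (c : ℤ_[p]) (a : A), ψ (algebraMap ℤ_[p] A c * a) = algebraMap ℤ_[p] Abar c * ψ a)
    (hψe : ∀ s t : M, Dbar.e (πbar s) (πbar t) = ψ (D.e s t))
    (f : Nbar →+ M) (hf : ∀ (g : absoluteGaloisGroup K) (x : Nbar), f (ρbar g x) = ρ g (f x))
    (μ : Abar →+ A) (hμ : ∀ (c : ℤ_[p]) (b : Abar), μ (algebraMap ℤ_[p] Abar c * b) = algebraMap ℤ_[p] A c * μ b)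
    (hμe : ∀ (s : M) (t : Nbar), D.e s (f t) = μ (Dbar.e (πbar s) t))
    (𝓕 : SelmerStructure ρ) (v : HeightOneSpectrum (𝓞 K))
    (hcv : hq.propagateStructure 𝓕 (Sum.inr v) = (𝓕 (Sum.inr v)).comap
      (ContinuousRep.cohomologyMap (ρbar.toLocal (Sum.inr v)) (ρ.toLocal (Sum.inr v)) f
        continuous_of_discreteTopology (fun _ t => hf _ t) 1))
    (hcσv : hq.propagateStructure 𝓕 (Sum.inr (cd.σ • v)) = (𝓕 (Sum.inr (cd.σ • v))).comap
      (ContinuousRep.cohomologyMap (ρbar.toLocal (Sum.inr (cd.σ • v))) (ρ.toLocal (Sum.inr (cd.σ • v))) f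
        continuous_of_discreteTopology (fun _ t => hf _ t) 1))
    (h4 : D.IsSelfOrthogonalAt 𝓕 v) :
    Dbar.IsSelfOrthogonalAt (hq.propagateStructure 𝓕) v := by
  -- notation-free abbreviations of the four local maps
  have iso : ∀ x ∈ hq.propagateStructure 𝓕 (Sum.inr v),
      ∀ y ∈ (hq.propagateStructure 𝓕 (Sum.inr (cd.σ • v))).map (cd.transportH1 ρbar v),
        Dbar.localCup (Sum.inr v) x y = 0 := by
    intro x' hx' y' hy'
    rw [IsQuotientBy.propagateStructure_apply, AddSubgroup.mem_map] at hx'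
    rw [IsQuotientBy.propagateStructure_apply, AddSubgroup.mem_map] at hy'
    obtain ⟨x, hx, rfl⟩ := hx'
    obtain ⟨z, hz, rfl⟩ := hy'
    obtain ⟨y, hy, rfl⟩ := AddSubgroup.mem_map.mp hz
    exact localCup_localCohomologyMap_eq_zero_of_ringChange hq D Dbar ψ hψ hψe v
      (h4.localCup_eq_zero hx (AddSubgroup.mem_map_of_mem _ hy))
  refine ⟨fun x => ⟨fun hx y hy => iso x hx y hy, fun hx => ?_⟩,
    fun y => ⟨fun hy x hx => iso x hx y hy, fun hy => ?_⟩⟩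
  · -- exactness, first clause: `f_* x̄ ∈ 𝓕_v` by H.4 for `T`
    rw [hcv]
    refine AddSubgroup.mem_comap.mpr ((h4.1 _).mpr fun y hy => ?_)
    obtain ⟨w, hw, rfl⟩ := AddSubgroup.mem_map.mp hy
    refine localCup_cohomologyMap_eq_zero hq D Dbar f hf μ hμ hμe v x _ (hx _ ?_)
    -- `(Tw π̄)_* (transport w) = transport (π̄_* w) ∈ transport (𝓕̄_{σ v})`
    rw [← hq.transportH1_localCohomologyMap v w]
    exact AddSubgroup.mem_map_of_mem _ (by
      rw [IsQuotientBy.propagateStructure_apply]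
      exact AddSubgroup.mem_map_of_mem _ hw)
  · -- exactness, second clause: write `ȳ = transport w̄` and show `f_* w̄ ∈ 𝓕_{σ v}`
    obtain ⟨w, rfl⟩ := cd.transportH1_surjective ρbar v y
    refine AddSubgroup.mem_map_of_mem _ ?_
    rw [hcσv]
    refine AddSubgroup.mem_comap.mpr ?_
    -- `transport (f_* w̄) = (Tw f)_* ȳ` lies in the transport of `𝓕_{σ v}` by H.4 for `T`
    have hmem : cd.transportH1 ρ v
        (ContinuousRep.cohomologyMap (ρbar.toLocal (Sum.inr (cd.σ • v))) (ρ.toLocal (Sum.inr (cd.σ • v))) f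
          continuous_of_discreteTopology (fun _ t => hf _ t) 1 w) ∈
        (𝓕 (Sum.inr (cd.σ • v))).map (cd.transportH1 ρ v) := by
      refine (h4.2 _).mpr fun x hx => ?_
      rw [cd.transportH1_cohomologyMap_of_equivariant ρbar ρ f hf v w]
      refine localCup_cohomologyMap_twist_eq_zero hq D Dbar f hf μ hμ hμe v x _ (hy _ ?_)
      rw [IsQuotientBy.propagateStructure_apply]
      exact AddSubgroup.mem_map_of_mem _ hx
    obtain ⟨z, hz, hzw⟩ := AddSubgroup.mem_map.mp hmem
    exact (cd.transportH1_injective ρ v hzw) ▸ hz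

/-! ## §4 The same in the currency of H.3 (`IsCartesianOnQuotAt`) -/

/-- Propagating along the identity presentation `T ↠ T/JT = T` (`J·T = 0`) does nothing.
[cite: Howard2004HeegnerKolyvagin, Def. 1.1.3 (arXiv p. 5 L93–99)] -/
theorem _root_.Literature.NumberTheory.GaloisCohomology.Howard2004.IsQuotientBy.propagate_of_id {J : Ideal R}
    (hJ : IsQuotientBy ρ J ρ LinearMap.id) (v : Place K) (L : AddSubgroup (galoisCohomology (ρ.toLocal v) 1)) :
    hJ.propagate v L = L := by
  have hid : ∀ z, hJ.localCohomologyMap v 1 z = z := by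
    intro z
    obtain ⟨χ, rfl⟩ := oneCocycleClass_surjective _ z
    refine (map_oneCocycleClass _ _ _ χ).trans ?_
    congr 1
  ext z
  constructor
  · rintro ⟨w, hw, rfl⟩
    rwa [hid]
  · intro hz
    exact ⟨z, hz, hid z⟩

/-- **H.4 base change from H.3.** As `isSelfOrthogonalAt_propagateStructure`, with the two `f`-cartesian identities
DERIVED from Howard's H.3 «`𝓕` is cartesian on `Quot(T)`» (`IsCartesianOnQuotAt`) at `v` and at `σ v`, applied to
the injective `Quot(T)`-morphism `f : T/IT → T/JT = T` (`f ∘ π̄ = r·`, `rI ⊂ J`, `J·T = 0`; for `T` free over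
`R/π^e` and `I = (π^i)`: `J = (π^e)`, `r = π^{e-i}`). (At places outside `Σ(𝓕)` the unramified condition is
cartesian by Howard's Lemma 1.1.5 = Mazur–Rubin Lemma 1.1.9; that discharge is the consumer's.)
[cite: Howard2004HeegnerKolyvagin, §1.3 H.3–H.4 and Remark 1.3.1 (arXiv p. 7 L65–82, L125–127), Def. 1.1.2–1.1.3 (p. 5 L88–99)] -/
theorem isSelfOrthogonalAt_propagateStructure_of_isCartesianOnQuotAt (hq : IsQuotientBy ρ I ρbar πbar)
    {J : Ideal R} (hJ : IsQuotientBy ρ J ρ LinearMap.id)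
    (D : DualityDatum p cd ρ A) (Dbar : DualityDatum p cd ρbar Abar)
    (ψ : A →+ Abar) (hψ : ∀ (c : ℤ_[p]) (a : A), ψ (algebraMap ℤ_[p] A c * a) = algebraMap ℤ_[p] Abar c * ψ a)
    (hψe : ∀ s t : M, Dbar.e (πbar s) (πbar t) = ψ (D.e s t))
    (r : R) (f : Nbar →ₗ[R] M) (hf : IsQuotMorphism ρ I J ρbar πbar ρ LinearMap.id r f)
    (hfinj : Function.Injective f)
    (μ : Abar →+ A) (hμ : ∀ (c : ℤ_[p]) (b : Abar), μ (algebraMap ℤ_[p] Abar c * b) = algebraMap ℤ_[p] A c * μ b)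
    (hμe : ∀ (s : M) (t : Nbar), D.e s (f t) = μ (Dbar.e (πbar s) t))
    (𝓕 : SelmerStructure ρ) (v : HeightOneSpectrum (𝓞 K))
    (h3v : IsCartesianOnQuotAt ρ R (Sum.inr v) (𝓕 (Sum.inr v)))
    (h3σv : IsCartesianOnQuotAt ρ R (Sum.inr (cd.σ • v)) (𝓕 (Sum.inr (cd.σ • v))))
    (h4 : D.IsSelfOrthogonalAt 𝓕 v) :
    Dbar.IsSelfOrthogonalAt (hq.propagateStructure 𝓕) v := by
  refine isSelfOrthogonalAt_propagateStructure hq D Dbar ψ hψ hψe f.toAddMonoidHom hf.equivariant μ hμ hμe 𝓕 v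
    ?_ ?_ h4
  · rw [IsQuotientBy.propagateStructure]
    refine (h3v I J Nbar M ρbar πbar ρ LinearMap.id hq hJ r f hf hfinj).trans ?_
    rw [hJ.propagate_of_id]
  · rw [IsQuotientBy.propagateStructure]
    refine (h3σv I J Nbar M ρbar πbar ρ LinearMap.id hq hJ r f hf hfinj).trans ?_
    rw [hJ.propagate_of_id]

end DualityDatum

end Literature.NumberTheory.GaloisCohomology.Howard2004

end
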